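import Summits.ResolutionOfSingularities.ResolutionOfSingularities.Theorems.WeightedInvariantIotaFlatTUpperSemicontinuousGraded
import Summits.ResolutionOfSingularities.ResolutionOfSingularities.Theorems.WeightedInvariantJFlatEssSmoothDescent
import Summits.ResolutionOfSingularities.ResolutionOfSingularities.Theorems.WeightedInvariantIota3SigmaFlagSpecialise
import HarnessLib

/-!
# The gap list of `stub_keyRungGrHomLE_three` with TWO LANDED DISCHARGES FOLDED IN: `hσ` only at FINITE residue fields, `hpt` only as GAP 2
# (door `HypersurfaceCentreConstruction`, stmt-ResolutionOfSingularities-19897; registered stub `stub_keyRungGrHomLE_three`; audit glue)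

Topic: `Summits/ResolutionOfSingularities/ResolutionOfSingularities/Theorems`. Helper for the door item `HypersurfaceCentreConstruction`
(stmt-ResolutionOfSingularities-19897, route `WeightedInvariant`), line `local-engine` (skeleton v3.12 `7a4b52ef`), def-free.  The gap list of
record `keyRungGrHomLE_three_of_descent'` (…IotaFlatTUpperSemicontinuousGraded, p812497) takes six hypotheses hD (desc-τ), `hσ`, (σ-pt), (hpt),
hgame, hres.  Two of them are PARTLY LANDED elsewhere in the tree and this file folds those landings in:

* `hσ` — `σ(T(X), g) ≤ σ(T, g)` at the generic fibre point `T → T(X) = T[X]_{𝔪T[X]}`.  For a local ring with INFINITE residue field this is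
  the equality `Iota3.iotaSigma_genericFibre_eq` (…Iota3SigmaFlagSpecialise, p542470: flags of `T(X)` with polynomial members specialise off a
  finite set of residues).  So `hσ` is needed ONLY for regular local rings with FINITE residue field (`Iota3.sigma_genericFibre_le_of_finite`).
* (hpt) — the equal-dimension-three point branch of `JFlatEssSmooth.jFlatT_map` on the ε-switched core `jFlatCoreE`.  Its ε = 1 half (GAP 1′,
  `bMax (φ f) = bMax f`) is `JFlatEssSmooth.bMax_map_eq_of_dim3` (…JFlatEssSmoothDescent), assembled there as
  `JFlatEssSmooth.jFlatT_map_of_sigma`; so (hpt) is needed ONLY as GAP 2: `jSigmaPt` commutes with `φ` at `ε = 0`, `𝔪_S S' = 𝔪'`, `dim S = 3`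
  (`Iota3.iotaJEssSmoothCompatibleLE_three_of_sigmaPt`: hc11 ⟸ (desc-τ) ∧ (σ-pt) ∧ GAP 2).

* **`keyRungGrHomLE_three_of_descent''`** — THE GAP LIST AFTER THIS FILE: (desc-τ) [door-proved for `T` essentially of finite type over a field:
  `Iota3.isTiePosition_descent_door`, p817623; as typed (all regular local rings) a typing item], `hσfin` (finite residue fields only), (σ-pt),
  GAP 2, hgame, the residue of the dominance word at the power positions.

[OURS · L1 W4.3 · audit glue]  Replaces the role of NO printed item; NOT a statement of the manuscript under review [claim: Hironaka2017, status:
under-review]; candidates stay candidates; AI work, weaker than expert review.  No definition; no axiom; every input is a hypothesis.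

## References

* H. Hironaka, *Characteristic polyhedra of singularities*, J. Math. Kyoto Univ. 7 (1967), §3. [Hironaka1967]
* H. Matsumura, *Commutative Ring Theory* (1987), §8. [Matsumura1987]
-/

noncomputable section

set_option linter.dupNamespace false -- mandated namespace `Summit.<Summit>.<Problem>` of this single-conjunct summit

open IsLocalRing Literature.AlgebraicGeometry.Resolution Polynomial
open Summit.ResolutionOfSingularities.ResolutionOfSingularities.Theorems
open Summit.ResolutionOfSingularities.ResolutionOfSingularities.Theorems.ContactCylinder

namespace Summit.ResolutionOfSingularities.ResolutionOfSingularities.Cruxes.HypersurfaceCentreConstruction.LocalEngine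

namespace Iota3

/-! ## §1 `hσ` is needed only at finite residue fields -/

/-- **`hσ` ⟸ `hσ` AT FINITE RESIDUE FIELDS.**  If `σ(T(X), g) ≤ σ(T, g)` holds for every regular local `T` of dimension `≤ 3` with FINITE
residue field, it holds for every regular local `T` of dimension `≤ 3`: at an infinite residue field the two sides are equal
(`iotaSigma_genericFibre_eq`). [OURS · audit glue] -/
theorem sigma_genericFibre_le_of_finite
    (hσfin : ∀ (T : Type) [CommRing T] [IsRegularLocalRing T] (g : T)
      [((maximalIdeal T).map (C : T →+* T[X])).IsPrime], Finite (ResidueField T) → ringKrullDim T ≤ 3 →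
      iotaSigma (Localization.AtPrime ((maximalIdeal T).map (C : T →+* T[X])))
        (algebraMap T[X] (Localization.AtPrime ((maximalIdeal T).map (C : T →+* T[X]))) (C g)) ≤ iotaSigma T g) :
    ∀ (T : Type) [CommRing T] [IsRegularLocalRing T] (g : T)
      [((maximalIdeal T).map (C : T →+* T[X])).IsPrime], ringKrullDim T ≤ 3 →
      iotaSigma (Localization.AtPrime ((maximalIdeal T).map (C : T →+* T[X])))
        (algebraMap T[X] (Localization.AtPrime ((maximalIdeal T).map (C : T →+* T[X]))) (C g)) ≤ iotaSigma T g := by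
  intro T _ _ g _ hd
  rcases finite_or_infinite (ResidueField T) with hfin | hinf
  · exact hσfin T g hfin hd
  · exact (iotaSigma_genericFibre_eq g).le

/-! ## §2 hc11 ⟸ (desc-τ) ∧ (σ-pt) ∧ GAP 2 -/

section Hc11

variable
  (hD : ∀ (T T' : Type) [CommRing T] [IsRegularLocalRing T] [CommRing T'] [IsRegularLocalRing T'] [Algebra T T']
    [IsLocalHom (algebraMap T T')] [Algebra.FormallySmooth T T'] [Algebra.EssFiniteType T T'] (g : T),
    ringKrullDim T' ≤ 3 → IsTiePosition T' (algebraMap T T' g) → IsTiePosition T g)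

include hD in
/-- **THE GAP hc11 OF THE P3 RUNG FROM (desc-τ), (σ-pt) AND GAP 2** (`Iota3.iotaJEssSmoothCompatibleLE_three_of_descent` with the point branch
(hpt) replaced by its ε = 0 half GAP 2 — the ε = 1 half GAP 1′ is `JFlatEssSmooth.bMax_map_eq_of_dim3`, via `JFlatEssSmooth.jFlatT_map_of_sigma`):
`IotaJEssSmoothCompatibleLE 3 Iota3.iotaFlatT Iota3.jFlatT`. [OURS · hc11 ⟸ (desc-τ) ∧ (σ-pt) ∧ GAP 2] -/
theorem iotaJEssSmoothCompatibleLE_three_of_sigmaPt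
    (hσpt : ∀ (T T' : Type) [CommRing T] [IsRegularLocalRing T] [CommRing T'] [IsRegularLocalRing T'] [Algebra T T']
      [IsLocalHom (algebraMap T T')] [Algebra.FormallySmooth T T'] [Algebra.EssFiniteType T T'] (g : T) (𝔮' : Ideal T')
      [𝔮'.IsPrime], ringKrullDim T' ≤ 3 →
      iotaSigma (Localization.AtPrime 𝔮') (algebraMap T (Localization.AtPrime 𝔮') g) =
        iotaSigma (Localization.AtPrime (𝔮'.comap (algebraMap T T')))
          (algebraMap T (Localization.AtPrime (𝔮'.comap (algebraMap T T'))) g))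
    (hgap2 : ∀ (T T' : Type) [CommRing T] [IsRegularLocalRing T] [CommRing T'] [IsRegularLocalRing T'] [Algebra T T']
      [IsLocalHom (algebraMap T T')] [Algebra.FormallySmooth T T'] [Algebra.EssFiniteType T T'] (g : T),
      ringKrullDim T' ≤ 3 → (maximalIdeal T).map (algebraMap T T') = maximalIdeal T' → ringKrullDim T = (3 : ℕ) →
      iotaEps T g = 0 → ∀ m : ℕ, jSigmaPt T' (algebraMap T T' g) m = (jSigmaPt T g m).map (algebraMap T T')) :
    IotaJEssSmoothCompatibleLE 3 iotaFlatT jFlatT := by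
  intro S S' _ _ _ _ _ _ _ _ f hdimS'
  classical
  haveI := isDomain_of_isRegularLocalRing S
  haveI := isDomain_of_isRegularLocalRing S'
  haveI : Module.Flat S S' := IotaOrderEssSmooth.flat_of_formallySmooth_of_essFiniteType S S'
  haveI : Module.FaithfullyFlat S S' := Module.FaithfullyFlat.of_flat_of_isLocalHom
  have hτ : iotaTau S' (algebraMap S S' f) = iotaTau S f := iotaTau_essSmooth_eq_of_descent hD S S' f hdimS'
  have hτpt : ∀ (𝔮' : Ideal S') [𝔮'.IsPrime], iotaTau (Localization.AtPrime 𝔮') (algebraMap S (Localization.AtPrime 𝔮') f) =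
      iotaTau (Localization.AtPrime (𝔮'.comap (algebraMap S S')))
        (algebraMap S (Localization.AtPrime (𝔮'.comap (algebraMap S S'))) f) :=
    fun 𝔮' _ => iotaTau_atPrime_eq_of_descent hD S S' hdimS' f 𝔮'
  refine ⟨?_, fun m => JFlatEssSmooth.jFlatT_map_of_sigma S S' hdimS' f hτ hτpt
    (fun h𝔪 hdim hε => hgap2 S S' f hdimS' h𝔪 hdim hε) m⟩
  -- dimensions: `dim S ≤ dim S' ≤ 3`
  obtain ⟨a, b, c, ha, hb, -, hab⟩ := EssSmoothLE2.exists_dims S S'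
  have hdimS : ringKrullDim S ≤ 3 := by
    have h : ((b : ℕ) : WithBot ℕ∞) ≤ 3 := hb ▸ hdimS'
    have hb3 : b ≤ 3 := by exact_mod_cast h
    rw [ha]; exact_mod_cast (show a ≤ 3 by omega)
  -- the generic prime `P` of the top `ι₀`-stratum of `S`, with `P S'` prime
  have hP : ∃ (P : Ideal S) (_ : P.IsPrime) (_ : (P.map (algebraMap S S')).IsPrime),
      topStratum iotaOrdEpsTau S f = {𝔮 | P ≤ 𝔮.asIdeal} := by
    by_cases hf0 : f = 0
    · refine ⟨⊥, Ideal.isPrime_bot, by rw [Ideal.map_bot]; exact Ideal.isPrime_bot, ?_⟩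
      subst hf0; exact topStratum_iotaOrdEpsTau_zero_eq_bot S hdimS
    by_cases hfu : IsUnit f
    · exact ⟨⊥, Ideal.isPrime_bot, by rw [Ideal.map_bot]; exact Ideal.isPrime_bot, topStratum_iotaOrdEpsTau_of_isUnit_eq_bot S hdimS hfu⟩
    · have hf : f ∈ maximalIdeal S := (IsLocalRing.mem_maximalIdeal f).mpr (mem_nonunits_iff.mpr hfu)
      obtain ⟨P, hPp, hreg, -, hE⟩ := topStratum_iotaOrdEpsTau_eq hdimS hf0 hf
      haveI := hPp
      exact ⟨P, hPp, isPrime_map_of_isRegularLocalRing_quotient S S' P hreg, hE⟩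
  obtain ⟨P, hPp, hP'p, hE⟩ := hP
  have hE' := JFlatEssSmooth.topStratum_iotaOrdEpsTau_map_of_eq S S' f hτ hτpt hE
  have hcomap : (P.map (algebraMap S S')).comap (algebraMap S S') = P := Ideal.comap_map_eq_self_of_faithfullyFlat (B := S') P
  -- the invariant: `ι₀` and the cylinder
  rw [iotaFlatT_eq_iff]
  refine ⟨JFlatEssSmooth.iotaOrdEpsTau_map_eq_of_iotaTau S S' f hτ, ?_⟩
  rw [iotaCylinder_eq_of_topStratum_eq iotaOrdEpsTau iotaSigma _ _ hE', iotaCylinder_eq_of_topStratum_eq iotaOrdEpsTau iotaSigma _ _ hE,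
    ← IsScalarTower.algebraMap_apply S S' (Localization.AtPrime (P.map (algebraMap S S'))) f,
    hσpt S S' f (P.map (algebraMap S S')) hdimS']
  exact StratumIff.iota_localization_congr iotaSigma hcomap f

end Hc11

end Iota3

/-! ## §3 The gap list of the registered stub after this file -/

open Iota3 in
/-- **P3 RUNG FOR THE NAMED PAIR MODULO THE GAP LIST AFTER THIS FILE** (`keyRungGrHomLE_three_of_descent'` with `hσ` restricted to FINITE residue
fields — `Iota3.sigma_genericFibre_le_of_finite` — and (hpt) replaced by GAP 2 — `Iota3.iotaJEssSmoothCompatibleLE_three_of_sigmaPt`): (desc-τ), `hσfin`,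
(σ-pt), GAP 2, hgame, the residue of the dominance word at the power positions. [OURS · audit glue] -/
theorem keyRungGrHomLE_three_of_descent'' (p : ℕ)
    (hD : ∀ (T T' : Type) [CommRing T] [IsRegularLocalRing T] [CommRing T'] [IsRegularLocalRing T'] [Algebra T T']
      [IsLocalHom (algebraMap T T')] [Algebra.FormallySmooth T T'] [Algebra.EssFiniteType T T'] (g : T),
      ringKrullDim T' ≤ 3 → IsTiePosition T' (algebraMap T T' g) → IsTiePosition T g)
    (hσfin : ∀ (T : Type) [CommRing T] [IsRegularLocalRing T] (g : T)
      [((maximalIdeal T).map (C : T →+* T[X])).IsPrime], Finite (ResidueField T) → ringKrullDim T ≤ 3 →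
      iotaSigma (Localization.AtPrime ((maximalIdeal T).map (C : T →+* T[X])))
        (algebraMap T[X] (Localization.AtPrime ((maximalIdeal T).map (C : T →+* T[X]))) (C g)) ≤ iotaSigma T g)
    (hσpt : ∀ (T T' : Type) [CommRing T] [IsRegularLocalRing T] [CommRing T'] [IsRegularLocalRing T'] [Algebra T T']
      [IsLocalHom (algebraMap T T')] [Algebra.FormallySmooth T T'] [Algebra.EssFiniteType T T'] (g : T) (𝔮' : Ideal T')
      [𝔮'.IsPrime], ringKrullDim T' ≤ 3 →
      iotaSigma (Localization.AtPrime 𝔮') (algebraMap T (Localization.AtPrime 𝔮') g) =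
        iotaSigma (Localization.AtPrime (𝔮'.comap (algebraMap T T')))
          (algebraMap T (Localization.AtPrime (𝔮'.comap (algebraMap T T'))) g))
    (hgap2 : ∀ (T T' : Type) [CommRing T] [IsRegularLocalRing T] [CommRing T'] [IsRegularLocalRing T'] [Algebra T T']
      [IsLocalHom (algebraMap T T')] [Algebra.FormallySmooth T T'] [Algebra.EssFiniteType T T'] (g : T),
      ringKrullDim T' ≤ 3 → (maximalIdeal T).map (algebraMap T T') = maximalIdeal T' → ringKrullDim T = (3 : ℕ) →
      iotaEps T g = 0 → ∀ m : ℕ, jSigmaPt T' (algebraMap T T' g) m = (jSigmaPt T g m).map (algebraMap T T'))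
    (hgame : CanonicalGameClauseHomLE 3 p iotaFlatT jFlatT)
    (hres : ∀ (k₀ : Type) [Field k₀] [CharP k₀ p] [PerfectField k₀]
      (S : Type) [CommRing S] [Algebra k₀ S] [Algebra.EssFiniteType k₀ S] [IsRegularLocalRing S] (f : S),
      ringKrullDim S = (3 : ℕ) → f ≠ 0 → f ∈ (maximalIdeal S) ^ 2 →
      ContactCylinder.topStratumPrime iotaOrdEpsTau S f = maximalIdeal S → iotaEps S f ≠ 1 →
      (∃ ℓ ∈ maximalIdeal S, f ∈ Ideal.span {ℓ ^ (adicOrder f).toNat} ⊔ maximalIdeal S ^ ((adicOrder f).toNat + 1)) →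
      ∀ (a b : ℕ), 0 < b →
      (∀ q' r₁' r₂' : ℕ, AdmissibleTriple q' r₁' r₂' → FlagReaches f (adicOrder f).toNat q' r₁' r₂' → r₁' * b ≤ a * r₂') →
      ∀ (g₁ g₂ g₁' g₂' : S) (q r₁ r₂ : ℕ), AdmissibleTriple q r₁ r₂ → r₁ * b = a * r₂ → q < r₂ → r₂ < r₁ →
        IsTwoFlag g₁ g₂ → IsTwoFlag g₁' g₂' →
        f ∈ flagContactFiltration g₁ g₂ q r₁ r₂ (r₁ * (adicOrder f).toNat) →
        f ∈ flagContactFiltration g₁' g₂' q r₁ r₂ (r₁ * (adicOrder f).toNat) →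
        g₂' ∈ flagContactFiltration g₁ g₂ q r₁ r₂ r₂) :
    KeyRungGrHomLE 3 p :=
  keyRungGrHomLE_three_of_residue_at_powers' p
    (iotaFlatT_torusFactorMonotoneLE_of_tauEssSmooth
      (fun T T' _ _ _ _ _ _ _ _ g hd => iotaTau_essSmooth_eq_of_descent hD T T' g hd) (sigma_genericFibre_le_of_finite hσfin) p)
    (iotaJEssSmoothCompatibleLE_three_of_sigmaPt hD hσpt hgap2) hgame hres (iotaFlatT_upperSemicontinuousGradedLE_three p)

end Summit.ResolutionOfSingularities.ResolutionOfSingularities.Cruxes.HypersurfaceCentreConstruction.LocalEngine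

end
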